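import Literature.AlgebraicGeometry.HodgeTheory.ComplexTorusIntegralHodgeClassesLefschetzClasses
import HarnessLib

/-!
# Direct images of Lefschetz classes are Lefschetz: Milne's Cor. 5.5 (`φ_*`), Cor. 5.6 / Thm. 5.10 (graphs `[Γ_φ]`) and Prop. 5.7 (correspondences between
# two abelian varieties) on the integral Hodge classes of polarized complex tori, for ARBITRARY homomorphisms `φ : X → Y`

Layer `Literature/AlgebraicGeometry/HodgeTheory`, namespace `Literature.AlgebraicGeometry.HodgeTheory.ComplexTorusCat`; lane `lit-hodgefound` (Track 2
foundations library, Layer A1/A4), prover seat `lit-hodgefound-p35` (gen 36, row g36-#4). Sequel of g36-#2 (`…LefschetzClasses`: `f^*`, cup products, `Δ_*`, the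
Künneth projectors, `Π_c`, composites and transposes ON ONE torus `X × X` preserve / are Lefschetz classes, i.e. have invariant forms in Layer A's
`divisorClasses = D•`, the `ℚ`-algebra of divisor classes). Milne's §5 has two more statements, the substantial ones: **Cor. 5.5** "For any regular map `φ : A → B`
of abelian varieties, `φ_*` maps Lefschetz classes on `A` to Lefschetz classes on `B`" (his proof: `φ_*` commutes with the Lefschetz GROUP `L(A × B)`, Prop. 5.4,
and Lefschetz classes are its invariants, Cor. 4.5) and **Cor. 5.6 / Thm. 5.10** "The graph of any regular map `α : A → B` of abelian varieties is Lefschetz"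
(`Γ_α = (id_A, α)_*(1_A)`). THIS FILE proves both on the integral Hodge classes of POLARIZED complex tori (tori carrying a Riemann form), for every homomorphism
`f : X ⟶ Y` of `ComplexTorusCat`, WITHOUT the Lefschetz group: the graph through g30's `[Γ_f] = (pr₂ − f pr₁)^*[pt_Y]` (`…CoincidenceNumbers`) and Layer A's
"the point class of a polarized torus is Lefschetz" (`IsRiemannForm.volumeForm_mem_divisorClasses`: `H^{2g}` is spanned by `c₁(L)^{∧g}`); the direct image through
Fulton's `f_* = (Γ_f)_* = pr₂_*([Γ_f] · pr₁^*(−))` (g27-#4 `integralHodgeClassesPushforward_sndHom_graphClass_cup_pullbackHom_fstHom`), the dictionary `pr₂_* = ∫_{X}`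
(g27-#12 `coe_integralHodgeClassesPushforward_sndHom`, Arapura's Lemma 5.5.1) and Layer A's theorem that INTEGRATION ALONG A POLARIZED FIBRE PRESERVES `D•`
(`pushforwardFst_mem_divisorClasses`, p08's row g8-#1: the operator `2Λ_{E₁ ⊞ 2E₂} − Λ_{E₁ ⊞ E₂} = Λ₁ ⊗ 1` on `D•(X₁ × X₂)`):

* §1 **`coe_pointIntegralHodgeClass_mem_divisorClasses`** — `[pt_Y] ∈ Dᵍ(Y)` for a polarized `Y` (Milne p. 663: "`H^{2g}(A)(g)` consists of Lefschetz classes — it is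
  generated by the class of `Dᵍ` for any ample divisor `D`");
* §2 **`coe_graphClass_mem_divisorClasses`** — COR. 5.6 / THM. 5.10: `[Γ_f] = (1, f)_*(1_X) ∈ Hdg^{dim Y}(X × Y, ℤ)` is a Lefschetz class for EVERY homomorphism
  `f : X → Y` into a polarized torus (`[Γ_f] = (pr₂ − f pr₁)^*[pt_Y]` and `f^*` preserves `D•`, g36-#2 §1); `coe_transposeGraphClass_mem_divisorClasses` (`ᵗΓ_f`);
* §3 **`coe_integralHodgeClassesPushforward_sndHom_mem_divisorClasses`**, **`…fstHom…`** — the projections: `pr₂_* : Hdgᵃ(X₁ × X₂, ℤ) → Hdg^{a − g₁}(X₂, ℤ)` maps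
  Lefschetz classes to Lefschetz classes when `X₁`, `X₂` are polarized (fibre integration), and so does `pr₁_* = pr₂_* ∘ τ_*`;
* §4 **`coe_integralHodgeClassesPushforward_mem_divisorClasses`** — COR. 5.5 IN FULL: for EVERY homomorphism `f : X → Y` between polarized complex tori and every
  `γ ∈ Hdgᵖ(X, ℤ)` with Lefschetz form, `f_* γ ∈ Hdg^{p + dim Y − dim X}(Y, ℤ)` has Lefschetz form (`f_* = pr₂_*([Γ_f] · pr₁^*(−))`, §2, §3);
* §5 PROP. 5.7 between TWO / THREE polarized tori: **`coe_integralHodgeClassesCorrAct_mem_divisorClasses`** (`α_*(x) = p₂_*(α · p₁^*x)` is Lefschetz for Lefschetz `α ∈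
  Hdgᵃ(X × Y, ℤ)`, `x ∈ Hdgᵖ(X, ℤ)` — "if `u` is Lefschetz, then `ū` maps `D(A)_k` into `D(B)_k`"), **`coe_integralHodgeClassesCorrCoact_mem_divisorClasses`** (`α^*(y) =
  p₁_*(α · p₂^*y)`), and **`coe_integralHodgeClassesCorrComp_mem_divisorClasses₃`** — the composite `β ∘ α = p₁₃_*(p₁₂^*α · p₂₃^*β)` of Lefschetz correspondences
  `α ∈ Hdgᵃ(X × Y, ℤ)`, `β ∈ Hdgᵇ(Y × Z, ℤ)` between THREE polarized tori is Lefschetz (g29-#3's bridge + Layer A `corrComp_mem_divisorClasses`; g36-#2 §4 was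
  `X = Y = Z`) — Milne's category of Lefschetz motives, integrally on complex tori.

Theorems only (kernel path): NO definition, NO named fact, no `sorry` (D-0026). Carriers: `divisorClasses (prodObj X Y).toIsog.Φ` (definitionally Layer A's
`divisorClasses (prodPeriod Φ_X Φ_Y)`); frames are arbitrary and explicit as in g27–g36.

## The sources, as printed

J. S. Milne, *Lefschetz classes on abelian varieties*, Duke Math. J. 96 (1999), held `paper:doi-10-1215-s0012-7094-99-09620-5`, p. 662 (p0024 L22–L28): "Because `φ^*`
is a homomorphism of graded `k`-algebras commuting with the cycle maps, it maps Lefschetz classes to Lefschetz classes. On the other hand, `φ_*` will not in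
general map Lefschetz classes to Lefschetz classes. For example let `Z` be a smooth closed connected subvariety of `X` whose cohomology class is not Lefschetz,
and let `φ` be the inclusion map `Z ↪ X`." p. 663 (p0025 L17, L25–L28, L44–L49): "Direct images of Lefschetz classes are Lefschetz. … **Proposition 5.4.** For any
regular map `φ : A → B` of abelian varieties, the map `φ_* : H^{2s}(A)(s) → H^{2s+2c}(B)(s + c)` commutes with the actions of `L(A × B)`. *Proof.* Let `g = dim A`.
Because `H^{2g}(A)(g)` consists of Lefschetz classes—it is generated by the class of `Dᵍ` for any ample divisor `D` on `A`—the action of `L(A)` on it is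
trivial. … **Corollary 5.5.** For any regular map `φ : A → B` of abelian varieties, `φ_*` maps Lefschetz classes on `A` to Lefschetz classes on `B`. …
**Corollary 5.6.** The graph of any regular map `α : A → B` of abelian varieties is Lefschetz. *Proof.* In fact, `Γ_α = (id_A, α)_*(1_A)`, and `1_A ∈ H⁰(A)` is
Lefschetz." p. 664 (p0026 L22–L28): "**Proposition 5.7.** Let `A` and `B` be abelian varieties over `Ω`. A cohomological correspondence `u` between `A` and `B` is
Lefschetz if and only if `ū : H*(A) → H*(B)` commutes with the actions of `L(A × B)`. If `u` is Lefschetz, then `ū` maps `D(A)_k` into `D(B)_k`. *Proof.* … The maps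
`φ^*`, `φ_*`, and cupping with a Lefschetz class, all preserve Lefschetz classes, whence the second statement." p. 665 (p0027 L16–L17, L45–L48): "**Theorem 5.10.**
For every adequate equivalence relation, the graph of a regular map of abelian varieties `φ : A → B` is a Lefschetz class on `A × B`. … the formula
`(φ × id)^*(Δ_B) = Δ_B ∘ Γ_φ = Γ_φ` (Fulton 1984, 16.1.1) shows that `Γ_φ` is also Lefschetz." W. Fulton, *Intersection Theory* (2nd ed. 1998), §16.1 Prop. 16.1.2 (c)
(p0295 L28–L30): "If `f : X → Y`, then `(Γ_f)_* = f_*` and `(Γ_f)^* = f^*`." D. Arapura, *Algebraic Geometry over the Complex Numbers* (2012), §5.5.1 Lemma 5.5.1 (p0114).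

## References
* [Milne1999LefschetzClasses] J. S. Milne, Lefschetz classes on abelian varieties, Duke Math. J. 96 (1999) 639–675 — §5: p0024 L22–L28, Prop. 5.4 – Cor. 5.6 (p0025 L17–L49),
  Prop. 5.7 (p0026 L22–L28), Thm. 5.10 with proof (p0027 L16–L48).
* [Fulton1998] W. Fulton, Intersection Theory, 2nd ed., Springer 1998 — §16.1 Def. 16.1.1–16.1.2, Prop. 16.1.2 (c) (p0293–p0295).
* [Lange2023AbelianVarietiesComplex] H. Lange, Abelian Varieties over the Complex Numbers, Springer 2023 — §6.2.2 Prop. 6.2.9 (p0304 L19–L24), §6.2.4 (6.10) (p0310),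
  §7.3.1 (p0336), §1.7 Lemma 1.7.5 (p0073).
* [Arapura2012] D. Arapura, Algebraic Geometry over the Complex Numbers, Universitext 2012 — §5.5.1 Lemma 5.5.1 (p0114 L1–L17).
-/

noncomputable section

open CategoryTheory Function

namespace Literature.AlgebraicGeometry.HodgeTheory

open Literature.AlgebraicGeometry.Motives Literature.AlgebraicGeometry.Motives.HodgeStructure
open Literature.Geometry.Kaehler Literature.Geometry.Kaehler.ComplexTorus

namespace ComplexTorusCat

/-! ## §1 The point class of a polarized torus is Lefschetz -/

section Point

variable (Y : ComplexTorusCat) {g₂ : ℕ} (eY : Fin (2 * g₂) ≃ Y.toIsog.ι) {η : Y.toIsog.E [⋀^Fin 2]→L[ℝ] ℝ} (hη : IsRiemannForm Y.toIsog.Φ η)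

include hη in
/-- **`[pt_Y] ∈ Dᵍ(Y)` ON A POLARIZED COMPLEX TORUS**: the point class (g29 `pointIntegralHodgeClass`, the volume form of the complex orientation) is a Lefschetz
class — "`H^{2g}(A)(g)` consists of Lefschetz classes—it is generated by the class of `Dᵍ` for any ample divisor `D` on `A`" (Layer A
`IsRiemannForm.volumeForm_mem_divisorClasses`: `c₁(L)^{∧g} ≠ 0` spans `H^{2g}`). [cite: Milne1999LefschetzClasses, §5 proof of Prop. 5.4 (p0025 L27–L28)]
[cite: Lange2023AbelianVarietiesComplex, §1.7 Lemma 1.7.5 (p0073 L1–L6) and §7.3.1 (p0336)] -/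
theorem coe_pointIntegralHodgeClass_mem_divisorClasses :
    ((pointIntegralHodgeClass Y eY : integralHodgeClasses Y.toIsog.Φ g₂) : Y.toIsog.E [⋀^Fin (2 * g₂)]→L[ℝ] ℂ) ∈ divisorClasses Y.toIsog.Φ g₂ := by
  rw [coe_pointIntegralHodgeClass]
  exact IsRiemannForm.volumeForm_mem_divisorClasses Y.toIsog.Φ hη eY

end Point

/-! ## §2 Cor. 5.6 / Thm. 5.10: the graph of every homomorphism into a polarized torus is a Lefschetz class -/

section Graph

variable {X Y : ComplexTorusCat} {n n' g g' g₂ : ℕ} (f : X ⟶ Y) (eX : Fin n ≃ X.toIsog.ι) (eY : Fin (2 * g₂) ≃ Y.toIsog.ι) (e : Fin n' ≃ (prodObj X Y).toIsog.ι)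
  (hX : n + 2 * 0 = n) (hg : g + g = n) (hc : n + 2 * g₂ = n') (hg' : g' + g' = n') {η : Y.toIsog.E [⋀^Fin 2]→L[ℝ] ℝ} (hη : IsRiemannForm Y.toIsog.Φ η)

include eY hη in
/-- **COROLLARY 5.6 / THEOREM 5.10 (Milne): THE GRAPH OF EVERY HOMOMORPHISM `f : X → Y` INTO A POLARIZED COMPLEX TORUS IS A LEFSCHETZ CLASS** — `([Γ_f] : form) ∈
D^{dim Y}(X × Y)` for `[Γ_f] = (1, f)_*(1_X) ∈ Hdg^{dim Y}(X × Y, ℤ)` (g27-#3, any frames): `[Γ_f] = (pr₂ − f pr₁)^*[pt_Y]` (g30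
`integralHodgeClassesPushforward_graphHom_unitIntegralHodgeClass`; Milne's "`(φ × id)^*(Δ_B) = Γ_φ`" composed with `[Δ_B] = (pr₂ − pr₁)^*[pt_B]`), `[pt_Y]` is
Lefschetz (§1) and pull-backs preserve Lefschetz classes (g36-#2 §1). No hypothesis on `X`. [cite: Milne1999LefschetzClasses, §5 Cor. 5.6 (p0025 L48–L49) and Thm. 5.10 with proof (p0027 L16–L48)]
[cite: Fulton1998, §16.1 Prop. 16.1.1 (c)(ii) (p0293 L25)] [cite: Lange2023AbelianVarietiesComplex, §6.2.2 (p0304 L15–L17)] -/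
theorem coe_graphClass_mem_divisorClasses :
    ((integralHodgeClassesPushforward 0 g₂ (graphHom f) eX e hX hg hc hg' (unitIntegralHodgeClass X) : integralHodgeClasses (prodObj X Y).toIsog.Φ g₂) :
        (X.toIsog.E × Y.toIsog.E) [⋀^Fin (2 * g₂)]→L[ℝ] ℂ) ∈ divisorClasses (prodObj X Y).toIsog.Φ g₂ := by
  rw [integralHodgeClassesPushforward_graphHom_unitIntegralHodgeClass f eX eY e hX hg hc hg']
  exact coe_integralHodgeClassesPullbackHom_mem_divisorClasses _ (coe_pointIntegralHodgeClass_mem_divisorClasses Y eY hη)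

variable (e' : Fin n' ≃ (prodObj Y X).toIsog.ι) {l₀ : ℕ} (hl : l₀ + 2 * g₂ = n')

include eY hX hg hc hη in
/-- **The transposed graph `ᵗΓ_f = τ_*[Γ_f] ∈ Hdg^{dim Y}(Y × X, ℤ)` is a Lefschetz class** (`τ_* = τ^*`, g27-#6, and §2).
[cite: Milne1999LefschetzClasses, §5 Cor. 5.6 (p0025 L48–L49)] [cite: Lange2023AbelianVarietiesComplex, §6.2.2 (p0304 L11–L17)] -/
theorem coe_transposeGraphClass_mem_divisorClasses :
    ((integralHodgeClassesPushforward g₂ g₂ (swapHom X Y) e e' hl hg' hl hg'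
        (integralHodgeClassesPushforward 0 g₂ (graphHom f) eX e hX hg hc hg' (unitIntegralHodgeClass X)) : integralHodgeClasses (prodObj Y X).toIsog.Φ g₂) :
          (Y.toIsog.E × X.toIsog.E) [⋀^Fin (2 * g₂)]→L[ℝ] ℂ) ∈ divisorClasses (prodObj Y X).toIsog.Φ g₂ := by
  rw [integralHodgeClassesPushforward_swapHom]
  exact coe_integralHodgeClassesPullbackHom_mem_divisorClasses _ (coe_graphClass_mem_divisorClasses f eX eY e hX hg hc hg' hη)

end Graph

/-! ## §3 The projections: `pr₂_*` and `pr₁_*` map Lefschetz classes to Lefschetz classes (polarized factors) -/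

section Projections

variable {X₁ X₂ : ComplexTorusCat} {g₁ n n₂ G g₂ a a' l₀ : ℕ} (e₁ : Fin (2 * g₁) ≃ X₁.toIsog.ι) (e : Fin n ≃ (prodObj X₁ X₂).toIsog.ι) (e₂ : Fin n₂ ≃ X₂.toIsog.ι)
  (hX : l₀ + 2 * a = n) (hG : G + G = n) (hY : l₀ + 2 * a' = n₂) (hg₂ : g₂ + g₂ = n₂)
  {η₁ : X₁.toIsog.E [⋀^Fin 2]→L[ℝ] ℝ} (hη₁ : IsRiemannForm X₁.toIsog.Φ η₁) {η₂ : X₂.toIsog.E [⋀^Fin 2]→L[ℝ] ℝ} (hη₂ : IsRiemannForm X₂.toIsog.Φ η₂)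

include e₁ hη₁ hη₂ in
/-- **`pr₂_*` MAPS LEFSCHETZ CLASSES TO LEFSCHETZ CLASSES** (Cor. 5.5 for the projection `pr₂ : X₁ × X₂ → X₂` of polarized complex tori): for `w ∈ Hdgᵃ(X₁ × X₂, ℤ)` with
`(w : form) ∈ Dᵃ(X₁ × X₂)`, the direct image `pr₂_* w ∈ Hdg^{a − dim X₁}(X₂, ℤ)` (g27-#2, any frames) has `(pr₂_* w : form) ∈ D^{a − dim X₁}(X₂)`: `pr₂_*` is integration
along the fibre `X₁` (g27-#12 `coe_integralHodgeClassesPushforward_sndHom`, Arapura's Lemma 5.5.1 / Lange's (6.10) `p_{2*}(x ⊗ y) = d(x) y`) and fibre integration over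
a polarized fibre preserves `D•` (Layer A `pushforwardFst_mem_divisorClasses`). [cite: Milne1999LefschetzClasses, §5 Cor. 5.5 (p0025 L44–L47) and Prop. 5.7 proof (p0026 L27–L28)]
[cite: Lange2023AbelianVarietiesComplex, §6.2.4 (6.10) (p0310 L33–L35)] [cite: Arapura2012, §5.5.1 Lemma 5.5.1 (p0114 L1–L17)] -/
theorem coe_integralHodgeClassesPushforward_sndHom_mem_divisorClasses (w : integralHodgeClasses (prodObj X₁ X₂).toIsog.Φ a)
    (hw : ((w : integralHodgeClasses (prodObj X₁ X₂).toIsog.Φ a) : (X₁.toIsog.E × X₂.toIsog.E) [⋀^Fin (2 * a)]→L[ℝ] ℂ) ∈ divisorClasses (prodObj X₁ X₂).toIsog.Φ a) :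
    ((integralHodgeClassesPushforward a a' (sndHom X₁ X₂) e e₂ hX hG hY hg₂ w : integralHodgeClasses X₂.toIsog.Φ a') : X₂.toIsog.E [⋀^Fin (2 * a')]→L[ℝ] ℂ) ∈
      divisorClasses X₂.toIsog.Φ a' := by
  -- ranks: `n = 2g₁ + n₂`
  have hE₁ : Module.finrank ℂ X₁.toIsog.E * 2 = 2 * g₁ := finrank_complex_mul_two X₁.toIsog.Φ e₁
  have hE₂ : Module.finrank ℂ X₂.toIsog.E * 2 = n₂ := finrank_complex_mul_two X₂.toIsog.Φ e₂
  have hE : Module.finrank ℂ (X₁.toIsog.E × X₂.toIsog.E) * 2 = n := finrank_complex_mul_two (prodObj X₁ X₂).toIsog.Φ e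
  rw [Module.finrank_prod] at hE
  obtain rfl : n = 2 * g₁ + n₂ := by omega
  have haa' : 2 * a = 2 * g₁ + 2 * a' := by omega
  rw [integralHodgeClassesPushforward_eq_of_enum a a' (sndHom X₁ X₂) e (sumEnum e₁ e₂) e₂ e₂ hX hG hY hg₂, coe_integralHodgeClassesPushforward_sndHom e₁ e₂ hX hG hY hg₂ haa' w]
  exact pushforwardFst_mem_divisorClasses X₁.toIsog.Φ X₂.toIsog.Φ hη₁.isNSForm (hη₁.exists_apply_ne_zero X₁.toIsog.Φ) hη₂.isNSForm (hη₂.exists_apply_ne_zero X₂.toIsog.Φ)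
    e₁ haa' hw

variable (e' : Fin n ≃ (prodObj X₂ X₁).toIsog.ι) {n₁ g₁' a₁ : ℕ} (e₁' : Fin n₁ ≃ X₁.toIsog.ι) (e₂' : Fin (2 * g₂) ≃ X₂.toIsog.ι) (hY₁ : l₀ + 2 * a₁ = n₁) (hg₁' : g₁' + g₁' = n₁)

include e' e₂' hη₁ hη₂ in
/-- **`pr₁_*` MAPS LEFSCHETZ CLASSES TO LEFSCHETZ CLASSES** (polarized factors): `pr₁ = τ ≫ pr₂` for the exchange `τ : X₁ × X₂ ⥲ X₂ × X₁`, `(f ≫ f′)_* = f′_* f_*`, `τ_*`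
preserves Lefschetz classes (g36-#2 `coe_integralHodgeClassesPushforward_swapHom_mem_divisorClasses`, here for two factors: `τ_* = τ^*`) and so does `pr₂_*`.
[cite: Milne1999LefschetzClasses, §5 Cor. 5.5 (p0025 L44–L47)] [cite: Fulton1998, §1.4 (p0023 L1: "(gf)_* = g_* f_*")] -/
theorem coe_integralHodgeClassesPushforward_fstHom_mem_divisorClasses (w : integralHodgeClasses (prodObj X₁ X₂).toIsog.Φ a)
    (hw : ((w : integralHodgeClasses (prodObj X₁ X₂).toIsog.Φ a) : (X₁.toIsog.E × X₂.toIsog.E) [⋀^Fin (2 * a)]→L[ℝ] ℂ) ∈ divisorClasses (prodObj X₁ X₂).toIsog.Φ a) :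
    ((integralHodgeClassesPushforward a a₁ (fstHom X₁ X₂) e e₁' hX hG hY₁ hg₁' w : integralHodgeClasses X₁.toIsog.Φ a₁) : X₁.toIsog.E [⋀^Fin (2 * a₁)]→L[ℝ] ℂ) ∈
      divisorClasses X₁.toIsog.Φ a₁ := by
  rw [← swapHom_sndHom X₁ X₂, integralHodgeClassesPushforward_comp a a (swapHom X₁ X₂) e e' hX hG hX hG a₁ (sndHom X₂ X₁) e₁' hY₁ hg₁']
  refine coe_integralHodgeClassesPushforward_sndHom_mem_divisorClasses e₂' e' e₁' hX hG hY₁ hg₁' hη₂ hη₁ _ ?_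
  rw [integralHodgeClassesPushforward_swapHom]
  exact coe_integralHodgeClassesPullbackHom_mem_divisorClasses _ hw

end Projections

/-! ## §4 Cor. 5.5: `f_*` maps Lefschetz classes to Lefschetz classes for every homomorphism of polarized complex tori -/

section DirectImage

variable {X Y : ComplexTorusCat} {g₁ g₂ : ℕ} (f : X ⟶ Y) (eX : Fin (2 * g₁) ≃ X.toIsog.ι) (eY : Fin (2 * g₂) ≃ Y.toIsog.ι) {p r l : ℕ}
  (hl : l + 2 * p = 2 * g₁) (hg₁ : g₁ + g₁ = 2 * g₁) (hr : l + 2 * r = 2 * g₂) (hg₂ : g₂ + g₂ = 2 * g₂)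
  {ηX : X.toIsog.E [⋀^Fin 2]→L[ℝ] ℝ} (hηX : IsRiemannForm X.toIsog.Φ ηX) {ηY : Y.toIsog.E [⋀^Fin 2]→L[ℝ] ℝ} (hηY : IsRiemannForm Y.toIsog.Φ ηY)

include hηX hηY in
/-- **COROLLARY 5.5 (Milne): `f_*` MAPS LEFSCHETZ CLASSES TO LEFSCHETZ CLASSES, FOR EVERY HOMOMORPHISM `f : X → Y` OF POLARIZED COMPLEX TORI.** For `γ ∈ Hdgᵖ(X, ℤ)` with
`(γ : form) ∈ Dᵖ(X)`, the Gysin image `f_* γ ∈ Hdgʳ(Y, ℤ)` (`r = p + dim Y − dim X`; g27-#2 `integralHodgeClassesPushforward` = `D_Y ∘ H_•(f) ∘ (− ∩ [X])`, any frames) has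
`(f_* γ : form) ∈ Dʳ(Y)`. Proof, without the Lefschetz group: `f_* = (Γ_f)_* = pr₂_*([Γ_f] · pr₁^*(−))` (Fulton's Prop. 16.1.2 (c), g27-#4), `[Γ_f]` is Lefschetz
(§2), `pr₁^*γ` is Lefschetz and `D•` is a ring (g36-#2 §1), and `pr₂_*` preserves Lefschetz classes (§3: fibre integration over the polarized `X`). Milne: "Direct
images of Lefschetz classes are Lefschetz" — whereas for a general smooth projective variety "`φ_*` will not in general map Lefschetz classes to Lefschetz classes".
[cite: Milne1999LefschetzClasses, §5 Prop. 5.4 – Cor. 5.5 (p0025 L17–L47) and p0024 L22–L28] [cite: Fulton1998, §16.1 Prop. 16.1.2 (c) (p0295 L28–L30)]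
[cite: Lange2023AbelianVarietiesComplex, §6.2.2 Prop. 6.2.9 (a) (p0304 L19–L24)] -/
theorem coe_integralHodgeClassesPushforward_mem_divisorClasses (γ : integralHodgeClasses X.toIsog.Φ p)
    (hγ : ((γ : integralHodgeClasses X.toIsog.Φ p) : X.toIsog.E [⋀^Fin (2 * p)]→L[ℝ] ℂ) ∈ divisorClasses X.toIsog.Φ p) :
    ((integralHodgeClassesPushforward p r f eX eY hl hg₁ hr hg₂ γ : integralHodgeClasses Y.toIsog.Φ r) : Y.toIsog.E [⋀^Fin (2 * r)]→L[ℝ] ℂ) ∈ divisorClasses Y.toIsog.Φ r := by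
  set e : Fin (2 * (g₁ + g₂)) ≃ (prodObj X Y).toIsog.ι := (finCongr (by omega : 2 * (g₁ + g₂) = 2 * g₁ + 2 * g₂)).trans (sumEnum eX eY)
  rw [← integralHodgeClassesPushforward_sndHom_graphClass_cup_pullbackHom_fstHom f eX eY e (by omega) hg₁ (by omega) (by omega) hg₂
    (rfl : g₂ + p = g₂ + p) hl (by omega) hr γ]
  exact coe_integralHodgeClassesPushforward_sndHom_mem_divisorClasses eX e eY _ _ hr hg₂ hηX hηY _
    (coe_integralHodgeClassesCup_mem_divisorClasses rfl (coe_graphClass_mem_divisorClasses f eX eY e _ hg₁ _ _ hηY)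
      (coe_integralHodgeClassesPullbackHom_mem_divisorClasses (fstHom X Y) hγ))

end DirectImage

/-! ## §5 Prop. 5.7 between two and three polarized tori: correspondence actions and composites -/

section Action

variable {X Y : ComplexTorusCat} {g₁ g₂ g : ℕ} (eX : Fin (2 * g₁) ≃ X.toIsog.ι) (eY : Fin (2 * g₂) ≃ Y.toIsog.ι) (e : Fin (2 * g) ≃ (prodObj X Y).toIsog.ι)
  (hg' : g + g = 2 * g) (hg₁ : g₁ + g₁ = 2 * g₁) (hg₂ : g₂ + g₂ = 2 * g₂) {a p q r l : ℕ} (hap : a + p = q) (hl : l + 2 * q = 2 * g) (hr : l + 2 * r = 2 * g₂)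
  {ηX : X.toIsog.E [⋀^Fin 2]→L[ℝ] ℝ} (hηX : IsRiemannForm X.toIsog.Φ ηX) {ηY : Y.toIsog.E [⋀^Fin 2]→L[ℝ] ℝ} (hηY : IsRiemannForm Y.toIsog.Φ ηY)

include eX hηX hηY in
/-- **PROPOSITION 5.7 (second statement): "if `u` is Lefschetz, then `ū` maps `D(A)_k` into `D(B)_k`"** — for a Lefschetz correspondence `α ∈ Hdgᵃ(X × Y, ℤ)` between
polarized complex tori and a Lefschetz `x ∈ Hdgᵖ(X, ℤ)`, Fulton's `α_*(x) = p_{2*}(α · p₁^*x) ∈ Hdgʳ(Y, ℤ)` (Def. 16.1.2, g27-#8's convention, any frames) is Lefschetz: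
`p₁^*`, `·`, and `p_{2*}` preserve Lefschetz classes (g36-#2 §1, §3 here). [cite: Milne1999LefschetzClasses, §5 Prop. 5.7 with proof (p0026 L22–L28)]
[cite: Fulton1998, §16.1 Def. 16.1.2 (p0295 L9–L15)] [cite: Lange2023AbelianVarietiesComplex, §6.2.2 (p0303 L19–L29: "`Z(α) := p_{2*}(Z · p₁^*α)`")] -/
theorem coe_integralHodgeClassesCorrAct_mem_divisorClasses (α : integralHodgeClasses (prodObj X Y).toIsog.Φ a) (x : integralHodgeClasses X.toIsog.Φ p)
    (hα : ((α : integralHodgeClasses (prodObj X Y).toIsog.Φ a) : (X.toIsog.E × Y.toIsog.E) [⋀^Fin (2 * a)]→L[ℝ] ℂ) ∈ divisorClasses (prodObj X Y).toIsog.Φ a)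
    (hx : ((x : integralHodgeClasses X.toIsog.Φ p) : X.toIsog.E [⋀^Fin (2 * p)]→L[ℝ] ℂ) ∈ divisorClasses X.toIsog.Φ p) :
    ((integralHodgeClassesPushforward q r (sndHom X Y) e eY hl hg' hr hg₂
        (integralHodgeClassesCup (prodObj X Y).toIsog.Φ hap α (integralHodgeClassesPullbackHom (fstHom X Y) p x)) : integralHodgeClasses Y.toIsog.Φ r) :
          Y.toIsog.E [⋀^Fin (2 * r)]→L[ℝ] ℂ) ∈ divisorClasses Y.toIsog.Φ r :=
  coe_integralHodgeClassesPushforward_sndHom_mem_divisorClasses eX e eY hl hg' hr hg₂ hηX hηY _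
    (coe_integralHodgeClassesCup_mem_divisorClasses hap hα (coe_integralHodgeClassesPullbackHom_mem_divisorClasses (fstHom X Y) hx))

variable (e' : Fin (2 * g) ≃ (prodObj Y X).toIsog.ι) {b s t : ℕ} (hab : a + b = s) (hl' : l + 2 * s = 2 * g) (ht : l + 2 * t = 2 * g₁)

include eY e' hηX hηY in
/-- **… and contravariantly: `α^*(y) = p_{1*}(α · p₂^*y)` is Lefschetz** for Lefschetz `α ∈ Hdgᵃ(X × Y, ℤ)`, `y ∈ Hdgᵇ(Y, ℤ)` (Def. 16.1.2; `p_{1*}` by §3).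
[cite: Milne1999LefschetzClasses, §5 Prop. 5.7 with proof (p0026 L22–L28)] [cite: Fulton1998, §16.1 Def. 16.1.2 (p0295 L9–L15)] -/
theorem coe_integralHodgeClassesCorrCoact_mem_divisorClasses (α : integralHodgeClasses (prodObj X Y).toIsog.Φ a) (y : integralHodgeClasses Y.toIsog.Φ b)
    (hα : ((α : integralHodgeClasses (prodObj X Y).toIsog.Φ a) : (X.toIsog.E × Y.toIsog.E) [⋀^Fin (2 * a)]→L[ℝ] ℂ) ∈ divisorClasses (prodObj X Y).toIsog.Φ a)
    (hy : ((y : integralHodgeClasses Y.toIsog.Φ b) : Y.toIsog.E [⋀^Fin (2 * b)]→L[ℝ] ℂ) ∈ divisorClasses Y.toIsog.Φ b) :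
    ((integralHodgeClassesPushforward s t (fstHom X Y) e eX hl' hg' ht hg₁
        (integralHodgeClassesCup (prodObj X Y).toIsog.Φ hab α (integralHodgeClassesPullbackHom (sndHom X Y) b y)) : integralHodgeClasses X.toIsog.Φ t) :
          X.toIsog.E [⋀^Fin (2 * t)]→L[ℝ] ℂ) ∈ divisorClasses X.toIsog.Φ t :=
  coe_integralHodgeClassesPushforward_fstHom_mem_divisorClasses e hl' hg' hηX hηY e' eX eY ht hg₁ _
    (coe_integralHodgeClassesCup_mem_divisorClasses hab hα (coe_integralHodgeClassesPullbackHom_mem_divisorClasses (sndHom X Y) hy))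

end Action

section Composition

variable {X Y Z : ComplexTorusCat} {gX gY gZ gXZ gT : ℕ} (eX : Fin (2 * gX) ≃ X.toIsog.ι) (eY : Fin (2 * gY) ≃ Y.toIsog.ι) (eZ : Fin (2 * gZ) ≃ Z.toIsog.ι)
  (eXZ : Fin (2 * gXZ) ≃ (prodObj X Z).toIsog.ι) (eT : Fin (2 * gT) ≃ (prodObj X (prodObj Y Z)).toIsog.ι) (hgXZ : gXZ + gXZ = 2 * gXZ) (hgT : gT + gT = 2 * gT)
  {a b k m l₃ : ℕ} (hab : a + b = k) (h3 : l₃ + 2 * k = 2 * gT) (h3' : l₃ + 2 * m = 2 * gXZ)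
  {ηX : X.toIsog.E [⋀^Fin 2]→L[ℝ] ℝ} (hηX : IsRiemannForm X.toIsog.Φ ηX) {ηY : Y.toIsog.E [⋀^Fin 2]→L[ℝ] ℝ} (hηY : IsRiemannForm Y.toIsog.Φ ηY)
  {ηZ : Z.toIsog.E [⋀^Fin 2]→L[ℝ] ℝ} (hηZ : IsRiemannForm Z.toIsog.Φ ηZ)

include eX eY eZ hηX hηY hηZ in
/-- **PROPOSITION 5.7 FOR THREE POLARIZED COMPLEX TORI — THE COMPOSITE OF LEFSCHETZ CORRESPONDENCES IS LEFSCHETZ**: for `α ∈ Hdgᵃ(X × Y, ℤ)`, `β ∈ Hdgᵇ(Y × Z, ℤ)` with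
Lefschetz forms, Fulton's composite `β ∘ α = p₁₃_*(p₁₂^*α · p₂₃^*β) ∈ Hdgᵐ(X × Z, ℤ)` (`m = a + b − dim Y`, g27-#5, any frames) has a Lefschetz form — g29-#3's bridge
(`β ∘ α` is Layer A's `corrComp = ∫_Y (p₂₃^*β ∧ p₁₂^*α)`) and Layer A's `corrComp_mem_divisorClasses` (`p₁₂^*`, `p₂₃^*`, `∧`, and the fibre integral over the polarized `Y`
preserve `D•`). Milne's Lefschetz motives form a category; g36-#2 §4 was the case `X = Y = Z`. [cite: Milne1999LefschetzClasses, §5 Prop. 5.7 with proof (p0026 L22–L28)]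
[cite: Fulton1998, §16.1 Def. 16.1.1 (p0293 L3–L7)] [cite: Lange2023AbelianVarietiesComplex, §6.2.2 (p0303 L40–L42)] -/
theorem coe_integralHodgeClassesCorrComp_mem_divisorClasses₃ (α : integralHodgeClasses (prodObj X Y).toIsog.Φ a) (β : integralHodgeClasses (prodObj Y Z).toIsog.Φ b)
    (hα : ((α : integralHodgeClasses (prodObj X Y).toIsog.Φ a) : (X.toIsog.E × Y.toIsog.E) [⋀^Fin (2 * a)]→L[ℝ] ℂ) ∈ divisorClasses (prodObj X Y).toIsog.Φ a)
    (hβ : ((β : integralHodgeClasses (prodObj Y Z).toIsog.Φ b) : (Y.toIsog.E × Z.toIsog.E) [⋀^Fin (2 * b)]→L[ℝ] ℂ) ∈ divisorClasses (prodObj Y Z).toIsog.Φ b) :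
    ((integralHodgeClassesPushforward k m (liftHom (fstHom X (prodObj Y Z)) (sndHom X (prodObj Y Z) ≫ sndHom Y Z)) eT eXZ h3 hgT h3' hgXZ
        (integralHodgeClassesCup (prodObj X (prodObj Y Z)).toIsog.Φ hab
          (integralHodgeClassesPullbackHom (liftHom (fstHom X (prodObj Y Z)) (sndHom X (prodObj Y Z) ≫ fstHom Y Z)) a α)
          (integralHodgeClassesPullbackHom (sndHom X (prodObj Y Z)) b β)) : integralHodgeClasses (prodObj X Z).toIsog.Φ m) :
        (X.toIsog.E × Z.toIsog.E) [⋀^Fin (2 * m)]→L[ℝ] ℂ) ∈ divisorClasses (prodObj X Z).toIsog.Φ m := by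
  -- dimension bookkeeping: `a + b = dim Y + m`
  have hEX : Module.finrank ℂ X.toIsog.E * 2 = 2 * gX := finrank_complex_mul_two X.toIsog.Φ eX
  have hEY : Module.finrank ℂ Y.toIsog.E * 2 = 2 * gY := finrank_complex_mul_two Y.toIsog.Φ eY
  have hEZ : Module.finrank ℂ Z.toIsog.E * 2 = 2 * gZ := finrank_complex_mul_two Z.toIsog.Φ eZ
  have hEXZ : Module.finrank ℂ (X.toIsog.E × Z.toIsog.E) * 2 = 2 * gXZ := finrank_complex_mul_two (prodObj X Z).toIsog.Φ eXZ
  have hET : Module.finrank ℂ (X.toIsog.E × (Y.toIsog.E × Z.toIsog.E)) * 2 = 2 * gT := finrank_complex_mul_two (prodObj X (prodObj Y Z)).toIsog.Φ eT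
  rw [Module.finrank_prod] at hEXZ hET
  rw [Module.finrank_prod] at hET
  have hsum : a + b = gY + m := by omega
  obtain ⟨d₁, l₁, d₂, l₂, h₁, hY, h₂, hm⟩ : ∃ d₁ l₁ d₂ l₂ : ℕ, 2 * a = d₁ + l₁ ∧ l₁ + d₂ = 2 * gY ∧ 2 * b = d₂ + l₂ ∧ d₁ + l₂ = 2 * m :=
    ⟨2 * a - (2 * gY - 2 * b), 2 * gY - 2 * b, 2 * gY - (2 * gY - 2 * b), 2 * b - (2 * gY - (2 * gY - 2 * b)), by omega, by omega, by omega, by omega⟩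
  set e₂ : Fin (l₁ + d₂) ≃ Y.toIsog.ι := (finCongr hY).trans eY
  rw [coe_integralHodgeClassesCorrComp_eq_corrComp eT eXZ e₂ hab h3 hgT h3' hgXZ h₁ h₂ hm α β]
  have hγ₁ : ((((α : integralHodgeClasses (prodObj X Y).toIsog.Φ a) : (X.toIsog.E × Y.toIsog.E) [⋀^Fin (2 * a)]→L[ℝ] ℂ).domDomCongr (finCongr h₁)).domDomCongr
      (finCongr h₁.symm)) ∈ divisorClasses (prodPeriod X.toIsog.Φ Y.toIsog.Φ) a := by
    rw [domDomCongr_finCongr_trans, domDomCongr_finCongr_self]; exact hα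
  have hγ₂ : ((((β : integralHodgeClasses (prodObj Y Z).toIsog.Φ b) : (Y.toIsog.E × Z.toIsog.E) [⋀^Fin (2 * b)]→L[ℝ] ℂ).domDomCongr (finCongr h₂)).domDomCongr
      (finCongr h₂.symm)) ∈ divisorClasses (prodPeriod Y.toIsog.Φ Z.toIsog.Φ) b := by
    rw [domDomCongr_finCongr_trans, domDomCongr_finCongr_self]; exact hβ
  exact corrComp_mem_divisorClasses X.toIsog.Φ Y.toIsog.Φ Z.toIsog.Φ hηX.isNSForm (hηX.exists_apply_ne_zero X.toIsog.Φ) hηY.isNSForm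
    (hηY.exists_apply_ne_zero Y.toIsog.Φ) hηZ.isNSForm (hηZ.exists_apply_ne_zero Z.toIsog.Φ) e₂ h₁.symm h₂.symm hm hγ₂ hγ₁

end Composition

end ComplexTorusCat

end Literature.AlgebraicGeometry.HodgeTheory
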